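import Literature.NumberTheory.Automorphic.HidaEngineLatticeDescent
import Literature.NumberTheory.Automorphic.HidaLatticeAnnihilatorReduction
import Literature.Algebra.Module.CharacterModuleAnnihilator
import HarnessLib

/-!
# The support hypotheses `hs₁`, `hs₂` of the levelwise engine at a dominant ordinary point

Topic `NumberTheory/Automorphic`; namespace `Literature.NumberTheory.Automorphic.BigHeckeGLn.TameLevel`;
definitions with bodies (the diamond family/ideal of an engine step) and theorems; no named fact, no
`sorry`.

For the engine step `n` (level `W = U(lv n, max(lv n,1))`, coefficients `O/pⁿ`, twisted level
modules `E_n(j)` of `HidaEngineBridge`, `e_v c₀ ≤ b₁ ≤ lv n`, trivial weight constants) let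
`I_n = (X_{d_q} − 1)_q ⊆ O[Syms]` be the DIAMOND IDEAL of the torus sections `d_q` of
`U(b₁,c)/U(c,c)` (`c = max(lv n,1)`), and let `s ∈ O[Syms]` kill the characteristic-`0` lattice
cohomology `H¹(U₀, Sym(O²))` and `H²(U₀, Sym(O²))` at the base level `U₀ = U(b₁,b₁)`.  Then
(weight bridge `Φ`, `HidaEngineLatticeDescent`, `HidaLatticeAnnihilatorReduction`):

* **`smul_mem_diamIdeal_smul_top_two`** — `s · E_n(2) ⊆ I_n · E_n(2)` (hypothesis `hs₂`);
* **`mul_self_smul_eq_zero_of_mem_torsionBySet_one`** — `s²` kills `E_n(1)[I_n]`, hence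
  **`range_lsmul_characterModule_le_one`** — `s² · E_n(1)^∨ ⊆ I_n · E_n(1)^∨` (hypothesis `hs₁`,
  `CharacterModuleAnnihilator`).

[cite: Hida1994AIF, §3, proof of Thm 3.2] [cite: KhareThorne2017, §6.5, Lemma 6.17]

## References

* H. Hida, Ann. Inst. Fourier 44 (1994), §3 (held). [Hida1994AIF]
* C. Khare, J. A. Thorne, Amer. J. Math. 139 (2017), §6.3–6.5 (arXiv:1409.7007, held). [KhareThorne2017]
-/

noncomputable section

open CategoryTheory IsDedekindDomain MvPolynomial Literature.Algebra.Module
open scoped NumberField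

namespace Literature.NumberTheory.Automorphic

namespace BigHeckeGLn

namespace TameLevel

open IntegralWeightGL2 LevelAction ParallelWeight PolyAction

variable {K : Type} [Field K] [NumberField K] {p : ℕ} [Fact p.Prime] (𝒰 : TameLevel 2 K p)
  [h𝒰 : Fact 𝒰.IsMaximalAbove] (O : Type) [CommRing O] {E : Type} [Field E] [CharZero E] (lv : ℕ → ℕ)
  {v : (K →+* E) → HeightOneSpectrum (𝓞 K)} (hv : ∀ τ, (p : 𝓞 K) ∈ (v τ).asIdeal)
  (φO : ∀ τ : K →+* E, (v τ).adicCompletionIntegers K →+* O) (n : ℕ)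
  (hred : ∀ τ (x : (v τ).adicCompletionIntegers K),
    Valued.v (x : (v τ).adicCompletion K) ≤ (WithZero.exp (-(lv n : ℤ)) : WithZero (Multiplicative ℤ)) →
      engRed p O φO n τ x = 0)
  (k c₀ : ℕ) {b₁ : ℕ} (hb₁ : ∀ w : PlacesAbove K p, BigHeckeGLn.ordAt w.1 (p : 𝓞 K) * c₀ ≤ b₁)
  (hb₁1 : 1 ≤ b₁) (hlvn : b₁ ≤ lv n)

/-! ### The diamond family and ideal of the engine step `n` -/

/-- The index set `Q_n = U(b₁,c)/U(c,c)`, `c = max(lv n, 1)`. [folklore] -/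
abbrev DiamIdx : Type :=
  𝒰.level b₁ (max (lv n) 1) ⧸ (𝒰.level (max (lv n) 1) (max (lv n) 1)).subgroupOf (𝒰.level b₁ (max (lv n) 1))

/-- The torus datum `d_q` of the coset `q`. [folklore] -/
abbrev diamDatum (q : 𝒰.DiamIdx lv n (b₁ := b₁)) : TorusDatum K p c₀ :=
  𝒰.torusSection h𝒰.out hb₁ (hlvn.trans (le_max_left _ _)) (le_max_right _ _) q

/-- **The diamond family `(X_{d_q} − 1)_q`**, `Fin`-indexed. [cite: KhareThorne2017, §6.5] -/
def diamFamily : Fin (Fintype.card (𝒰.DiamIdx lv n (b₁ := b₁))) → MvPolynomial (𝒰.Syms c₀) O :=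
  fun i => X (Sum.inr (𝒰.diamDatum lv n c₀ hb₁ hlvn ((Fintype.equivFin _).symm i))) - 1

/-- **The diamond ideal `I_n = (X_{d_q} − 1)_q`.** [cite: KhareThorne2017, §6.5] -/
abbrev diamIdeal : Ideal (MvPolynomial (𝒰.Syms c₀) O) :=
  Ideal.span (Set.range (𝒰.diamFamily O lv n c₀ hb₁ hlvn))

/-- `X_{d_q} − 1 ∈ I_n`. [folklore] -/
theorem X_sub_one_mem_diamIdeal (q : 𝒰.DiamIdx lv n (b₁ := b₁)) :
    X (Sum.inr (𝒰.diamDatum lv n c₀ hb₁ hlvn q)) - 1 ∈ 𝒰.diamIdeal O lv n c₀ hb₁ hlvn := by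
  refine Ideal.subset_span ⟨Fintype.equivFin _ q, ?_⟩
  simp [diamFamily]

/-- The elements of `I_n` are killed by every ring homomorphism killing the `X_{d} − 1`. [folklore] -/
theorem eq_zero_of_mem_diamIdeal {A : Type*} [CommRing A] (χ : MvPolynomial (𝒰.Syms c₀) O →+* A)
    (hχ : ∀ d : TorusDatum K p c₀, χ (X (Sum.inr d)) = 1) {r : MvPolynomial (𝒰.Syms c₀) O}
    (hr : r ∈ 𝒰.diamIdeal O lv n c₀ hb₁ hlvn) : χ r = 0 := by
  have hle : 𝒰.diamIdeal O lv n c₀ hb₁ hlvn ≤ RingHom.ker χ := Ideal.span_le.2 (by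
    rintro _ ⟨i, rfl⟩
    rw [SetLike.mem_coe, RingHom.mem_ker, diamFamily, map_sub, hχ, map_one, sub_self])
  exact hle hr

/-! ### Lifting through the weight bridge -/

section Bridge

include hb₁1 hlvn in
/-- `Φ` is a bijection `Ord H^j(W, Sym) → E_n(j)` (`j = 1, 2`). [cite: KhareThorne2017, §6.4, Prop. 6.13] -/
theorem bijOn_engBridge (j : ℕ) [Finite (𝒰.latCohomology O lv φO n k j)] [Finite (𝒰.engCohomology O lv n j)] :
    Set.BijOn (𝒰.engBridge O lv hv φO n hred k j) (𝒰.latOrd O lv hv φO n hred k j) (𝒰.engOrd O lv n j) :=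
  𝒰.bijOn_engBridge_latOrd_engOrd O lv hv φO n hred (hb₁1.trans hlvn) (le_max_left _ _)
    (engRed_uniformizer_pow_eq_zero O lv φO n hred) j

include hb₁1 hlvn in
/-- **Every element of `E_n(j)` lifts to an ordinary lattice class.** [folklore] -/
theorem exists_lift (j : ℕ) [Finite (𝒰.latCohomology O lv φO n k j)] [Finite (𝒰.engCohomology O lv n j)]
    (m : 𝒰.EngModTw O lv k c₀ n j) :
    ∃ y ∈ 𝒰.latOrd O lv hv φO n hred k j, 𝒰.engBridge O lv hv φO n hred k j y = (m.toEngMod : 𝒰.engCohomology O lv n j) := by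
  obtain ⟨y, hy, hye⟩ := (𝒰.bijOn_engBridge O lv hv φO n hred k hb₁1 hlvn j).surjOn (EngMod.coe_mem 𝒰 m.toEngMod)
  exact ⟨y, hy, hye⟩

variable (hN : ∀ d : TorusDatum K p c₀,
    (∏ τ, engRed p O φO n τ ((d.units ⟨v τ, hv τ⟩ 1 : ((v τ).adicCompletionIntegers K)ˣ) :
        (v τ).adicCompletionIntegers K) ^ (k - 2)) =
      Ideal.Quotient.mk (Ideal.span {((p : O)) ^ n}) (((Algebra.norm ℤ d.2.u : ℤ) : O) ^ (k - 2)))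

include hN hb₁1 hlvn in
/-- **The bridge is `O[Syms]`-linear on lifts**: `(z • m : H^j) = Φ(π(z) y)` when `Φ y = m`, `y` ordinary.
[cite: KhareThorne2017, §6.5] -/
theorem coe_twSmul_of_lift (j : ℕ) [Finite (𝒰.latCohomology O lv φO n k j)] [Finite (𝒰.engCohomology O lv n j)]
    (z : MvPolynomial (𝒰.Syms c₀) O) (m : 𝒰.EngModTw O lv k c₀ n j) {y : 𝒰.latCohomology O lv φO n k j}
    (hy : y ∈ 𝒰.latOrd O lv hv φO n hred k j)
    (hm : 𝒰.engBridge O lv hv φO n hred k j y = (m.toEngMod : 𝒰.engCohomology O lv n j)) :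
    ((z • m).toEngMod : 𝒰.engCohomology O lv n j) =
      𝒰.engBridge O lv hv φO n hred k j (𝒰.latPolyHom O lv hv φO n hred k c₀ j z y) := by
  have hbij := 𝒰.bijOn_engBridge O lv hv φO n hred k hb₁1 hlvn j
  have hΦy : 𝒰.engBridge O lv hv φO n hred k j y ∈ 𝒰.engOrd O lv n j := hbij.mapsTo hy
  have hΦzy : 𝒰.engBridge O lv hv φO n hred k j (𝒰.latPolyHom O lv hv φO n hred k c₀ j z y) ∈ 𝒰.engOrd O lv n j :=
    hbij.mapsTo (𝒰.latPolyHom_apply_mem_latOrd O lv hv φO n hred j z hy)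
  have hmeq : m = EngModTw.ofEngMod 𝒰 O lv k c₀ (EngMod.mk 𝒰 O lv _ hΦy) :=
    EngMod.ext 𝒰 (hm.symm.trans (EngMod.coe_mk 𝒰 _ hΦy).symm)
  rw [hmeq, 𝒰.twSmul_mk_engBridge O lv hv φO n hred hN j z hΦy hΦzy]
  rfl

/-- The coercion `E_n(j) → H^j` is additive. [folklore] -/
def engModValHom (j : ℕ) : 𝒰.EngModTw O lv k c₀ n j →+ 𝒰.engCohomology O lv n j where
  toFun m := (m.toEngMod : 𝒰.engCohomology O lv n j)
  map_zero' := rfl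
  map_add' _ _ := rfl

omit h𝒰 in
/-- Unfolding `engModValHom`. [folklore] -/
@[simp]
theorem engModValHom_apply (j : ℕ) (m : 𝒰.EngModTw O lv k c₀ n j) :
    𝒰.engModValHom O lv n k c₀ j m = (m.toEngMod : 𝒰.engCohomology O lv n j) :=
  rfl

end Bridge

/-! ### `hs₂`: `s · E_n(2) ⊆ I_n · E_n(2)` -/

section Two

variable (hN : ∀ d : TorusDatum K p c₀,
    (∏ τ, engRed p O φO n τ ((d.units ⟨v τ, hv τ⟩ 1 : ((v τ).adicCompletionIntegers K)ˣ) :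
        (v τ).adicCompletionIntegers K) ^ (k - 2)) =
      Ideal.Quotient.mk (Ideal.span {((p : O)) ^ n}) (((Algebra.norm ℤ d.2.u : ℤ) : O) ^ (k - 2)))
  [IsDomain O] (hpn : ((p : O)) ^ n ≠ 0)
  (hfin : ∀ (cv : PlacesAbove K p → ℕ) (i : ℕ),
    Finite (cohomology (globalEmbedding 2 K) (integralMonoid K v) (engLatAction p O φO n k) (𝒰.depthLevel b₁ cv) i))
  [Finite (𝒰.latCohomology O lv φO n k 2)] [Finite (𝒰.engCohomology O lv n 2)]
  [Finite (cohomology (globalEmbedding 2 K) (integralMonoid K v) (engLatAction p O φO n k)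
    (𝒰.level (max (lv n) 1) (max (lv n) 1)) 2)]
  [Subsingleton (cohomology (globalEmbedding 2 K) (integralMonoid K v) (symLatticeAction O E K k v φO) (𝒰.level b₁ b₁) 3)]
  (hcd : ∀ (W : Subgroup (FiniteAdelicGL 2 K)),
    IsOpen (W : Set (FiniteAdelicGL 2 K)) → IsCompact (W : Set (FiniteAdelicGL 2 K)) →
    (∀ γ ∈ W.comap (globalEmbedding 2 K), IsOfFinOrder γ → γ = 1) →
    ∀ (A : Rep ℤ (W.comap (globalEmbedding 2 K))) (q : ℕ), 3 ≤ q → Subsingleton (groupCohomology A q))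
  (htf : ∀ (x : FiniteAdelicGL 2 K) (γ : GL (Fin 2) K), IsOfFinOrder γ →
    x⁻¹ * globalEmbedding 2 K γ * x ∈ 𝒰.level b₁ (max (lv n) 1) → γ = 1)

include hN hpn hfin hcd htf hb₁1 hred in
/-- **`hs₂`: `s · m ∈ I_n · E_n(2)` for every `m ∈ E_n(2)`** when `s ∈ O[Syms]` kills `H²(U₀, Sym(O²))` and
`H³(U₀, Sym(O²)) = 0`. [cite: Hida1994AIF, §3, proof of Thm 3.2] [cite: KhareThorne2017, §6.5, Lemma 6.17] -/
theorem smul_mem_diamIdeal_smul_top_two (s : MvPolynomial (𝒰.Syms c₀) O)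
    (hs2 : ∀ x : cohomology (globalEmbedding 2 K) (integralMonoid K v) (symLatticeAction O E K k v φO) (𝒰.level b₁ b₁) 2,
      𝒰.symPolyHom (symLatticeAction O E K k v φO) (𝒰.level_le_integralMonoid_of_forall_mem hv b₁ b₁) c₀
        (fun _ hg => 𝒰.goodElements_le_integralMonoid v hg) (fun u => diamondPi_mem_integralMonoid' v hv u)
        (RingHom.id O) h𝒰.out 2 s x = 0)
    (m : 𝒰.EngModTw O lv k c₀ n 2) :
    s • m ∈ 𝒰.diamIdeal O lv n c₀ hb₁ hlvn • (⊤ : Submodule (MvPolynomial (𝒰.Syms c₀) O) (𝒰.EngModTw O lv k c₀ n 2)) := by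
  classical
  have hbij := 𝒰.bijOn_engBridge O lv hv φO n hred k hb₁1 hlvn 2
  obtain ⟨y, hy, hye⟩ := 𝒰.exists_lift O lv hv φO n hred k c₀ hb₁1 hlvn 2 m
  -- `s` kills `H²(U₀, Sym((O/pⁿ)²))` (reduction onto in the top degree)
  have hsS : ∀ y₀ : cohomology (globalEmbedding 2 K) (integralMonoid K v) (engLatAction p O φO n k) (𝒰.level b₁ b₁) 2,
      𝒰.levPolyHom O hv φO n k c₀ b₁ b₁ 2 s y₀ = 0 := fun y₀ =>
    𝒰.symPolyHom_apply_eq_zero_of_subsingleton O k hv φO hpn (𝒰.level_le_integralMonoid_of_forall_mem hv b₁ b₁)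
      h𝒰.out c₀ 2 s hs2 y₀
  -- descent: `π(s) y = ∑_q π(X_{d_q} − 1) b_q`
  obtain ⟨b, hb, hsum⟩ := 𝒰.exists_levPolyHom_eq_sum_two O lv hv φO n k c₀ hb₁ hb₁1 hlvn hfin hcd htf s hsS y hy
  -- the elements `m_q := Φ(b_q)` of `E_n(2)`
  have hΦb : ∀ q, 𝒰.engBridge O lv hv φO n hred k 2 (b q) ∈ 𝒰.engOrd O lv n 2 := fun q => hbij.mapsTo (hb q)
  set mq : 𝒰.DiamIdx lv n (b₁ := b₁) → 𝒰.EngModTw O lv k c₀ n 2 :=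
    fun q => EngModTw.ofEngMod 𝒰 O lv k c₀ (EngMod.mk 𝒰 O lv _ (hΦb q)) with hmq
  have hsm : s • m = ∑ q, (X (Sum.inr (𝒰.diamDatum lv n c₀ hb₁ hlvn q)) - 1 : MvPolynomial (𝒰.Syms c₀) O) • mq q := by
    refine EngMod.ext 𝒰 ?_
    change 𝒰.engModValHom O lv n k c₀ 2 (s • m) =
      𝒰.engModValHom O lv n k c₀ 2 (∑ q, (X (Sum.inr (𝒰.diamDatum lv n c₀ hb₁ hlvn q)) - 1 : MvPolynomial (𝒰.Syms c₀) O) • mq q)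
    rw [map_sum, engModValHom_apply, 𝒰.coe_twSmul_of_lift O lv hv φO n hred k c₀ hb₁1 hlvn hN 2 s m hy hye]
    change 𝒰.engBridge O lv hv φO n hred k 2 (𝒰.levPolyHom O hv φO n k c₀ (lv n) (max (lv n) 1) 2 s y) = _
    rw [hsum, map_sum]
    refine Finset.sum_congr rfl fun q _ => ?_
    rw [engModValHom_apply, 𝒰.coe_twSmul_of_lift O lv hv φO n hred k c₀ hb₁1 hlvn hN 2 _ (mq q) (hb q) (by rw [hmq]; rfl)]
    rfl
  rw [hsm]
  exact Submodule.sum_mem _ fun q _ =>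
    Submodule.smul_mem_smul (𝒰.X_sub_one_mem_diamIdeal O lv n c₀ hb₁ hlvn q) Submodule.mem_top

include hN hpn hfin hcd htf hb₁1 hred in
/-- `hs₂` in the form consumed by the levelwise engine. [cite: Hida1994AIF, §3, proof of Thm 3.2] -/
theorem range_lsmul_le_two (s : MvPolynomial (𝒰.Syms c₀) O)
    (hs2 : ∀ x : cohomology (globalEmbedding 2 K) (integralMonoid K v) (symLatticeAction O E K k v φO) (𝒰.level b₁ b₁) 2,
      𝒰.symPolyHom (symLatticeAction O E K k v φO) (𝒰.level_le_integralMonoid_of_forall_mem hv b₁ b₁) c₀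
        (fun _ hg => 𝒰.goodElements_le_integralMonoid v hg) (fun u => diamondPi_mem_integralMonoid' v hv u)
        (RingHom.id O) h𝒰.out 2 s x = 0) :
    LinearMap.range (LinearMap.lsmul (MvPolynomial (𝒰.Syms c₀) O) (𝒰.EngModTw O lv k c₀ n 2) s) ≤
      𝒰.diamIdeal O lv n c₀ hb₁ hlvn • (⊤ : Submodule (MvPolynomial (𝒰.Syms c₀) O) (𝒰.EngModTw O lv k c₀ n 2)) := by
  rintro _ ⟨m, rfl⟩
  rw [LinearMap.lsmul_apply]
  exact 𝒰.smul_mem_diamIdeal_smul_top_two O lv hv φO n hred k c₀ hb₁ hb₁1 hlvn hN hpn hfin hcd htf s hs2 m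

end Two

/-! ### `hs₁`: `s²` kills `E_n(1)[I_n]` -/

section One

variable (hN : ∀ d : TorusDatum K p c₀,
    (∏ τ, engRed p O φO n τ ((d.units ⟨v τ, hv τ⟩ 1 : ((v τ).adicCompletionIntegers K)ˣ) :
        (v τ).adicCompletionIntegers K) ^ (k - 2)) =
      Ideal.Quotient.mk (Ideal.span {((p : O)) ^ n}) (((Algebra.norm ℤ d.2.u : ℤ) : O) ^ (k - 2)))
  [IsDomain O] (hpn : ((p : O)) ^ n ≠ 0) (τ₀ : K →+* E)
  (hfin : ∀ (cv : PlacesAbove K p → ℕ) (i : ℕ),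
    Finite (cohomology (globalEmbedding 2 K) (integralMonoid K v) (engLatAction p O φO n k) (𝒰.depthLevel b₁ cv) i))
  [Finite (𝒰.latCohomology O lv φO n k 1)] [Finite (𝒰.engCohomology O lv n 1)]
  [Finite (cohomology (globalEmbedding 2 K) (integralMonoid K v) (engLatAction p O φO n k)
    (𝒰.level (max (lv n) 1) (max (lv n) 1)) 1)]

include hN hpn τ₀ hfin hb₁1 hred in
/-- **`s²` kills every `e ∈ E_n(1)` fixed by the `X_{d_q}`** when `s ∈ O[Syms]` kills `H¹` and `H²` of
`(U₀, Sym(O²))`. [cite: Hida1994AIF, §3, proof of Thm 3.2] [cite: KhareThorne2017, §6.5, Lemma 6.17] -/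
theorem mul_self_smul_eq_zero_of_mem_torsionBySet_one (s : MvPolynomial (𝒰.Syms c₀) O)
    (hs1 : ∀ x : cohomology (globalEmbedding 2 K) (integralMonoid K v) (symLatticeAction O E K k v φO) (𝒰.level b₁ b₁) 1,
      𝒰.symPolyHom (symLatticeAction O E K k v φO) (𝒰.level_le_integralMonoid_of_forall_mem hv b₁ b₁) c₀
        (fun _ hg => 𝒰.goodElements_le_integralMonoid v hg) (fun u => diamondPi_mem_integralMonoid' v hv u)
        (RingHom.id O) h𝒰.out 1 s x = 0)
    (hs2 : ∀ x : cohomology (globalEmbedding 2 K) (integralMonoid K v) (symLatticeAction O E K k v φO) (𝒰.level b₁ b₁) 2,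
      𝒰.symPolyHom (symLatticeAction O E K k v φO) (𝒰.level_le_integralMonoid_of_forall_mem hv b₁ b₁) c₀
        (fun _ hg => 𝒰.goodElements_le_integralMonoid v hg) (fun u => diamondPi_mem_integralMonoid' v hv u)
        (RingHom.id O) h𝒰.out 2 s x = 0)
    (e : 𝒰.EngModTw O lv k c₀ n 1)
    (he : e ∈ Submodule.torsionBySet (MvPolynomial (𝒰.Syms c₀) O) (𝒰.EngModTw O lv k c₀ n 1)
      (Set.range (𝒰.diamFamily O lv n c₀ hb₁ hlvn))) :
    (s * s) • e = 0 := by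
  classical
  have hbij := 𝒰.bijOn_engBridge O lv hv φO n hred k hb₁1 hlvn 1
  obtain ⟨y, hy, hye⟩ := 𝒰.exists_lift O lv hv φO n hred k c₀ hb₁1 hlvn 1 e
  -- `X_{d_q} • e = e`, hence `π(X_{d_q}) y = y`
  have heq : ∀ q, (X (Sum.inr (𝒰.diamDatum lv n c₀ hb₁ hlvn q)) : MvPolynomial (𝒰.Syms c₀) O) • e = e := fun q => by
    have h0 := (Submodule.mem_torsionBySet_iff _ _).1 he ⟨_, ⟨Fintype.equivFin _ q, rfl⟩⟩
    simp only [diamFamily, Equiv.symm_apply_apply, sub_smul, one_smul, sub_eq_zero] at h0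
    exact h0
  have hyq : ∀ q, 𝒰.levPolyHom O hv φO n k c₀ (lv n) (max (lv n) 1) 1 (X (Sum.inr (𝒰.diamDatum lv n c₀ hb₁ hlvn q))) y = y :=
    fun q => by
    refine hbij.injOn (𝒰.latPolyHom_apply_mem_latOrd O lv hv φO n hred 1 _ hy) hy ?_
    rw [← 𝒰.coe_twSmul_of_lift O lv hv φO n hred k c₀ hb₁1 hlvn hN 1 _ e hy hye, heq q, hye]
  -- descent to `U₀`: `y = res x₀`
  obtain ⟨x₀, -, hx₀⟩ := 𝒰.exists_mem_levOrd_res_eq_one O lv hv φO n hred k c₀ hb₁ hb₁1 hlvn τ₀ hfin y hy hyq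
  -- `s²` kills `H¹(U₀, Sym((O/pⁿ)²))`
  have hsq : 𝒰.levPolyHom O hv φO n k c₀ b₁ b₁ 1 (s * s) x₀ = 0 := by
    rw [map_mul, Module.End.mul_apply]
    exact 𝒰.symPolyHom_symPolyHom_apply_eq_zero O k hv φO hpn (𝒰.level_le_integralMonoid_of_forall_mem hv b₁ b₁)
      h𝒰.out c₀ (rfl : 1 + 1 = 2) s hs1 hs2 x₀
  -- hence `π(s²) y = 0` and `s² • e = 0`
  have hy0 : 𝒰.latPolyHom O lv hv φO n hred k c₀ 1 (s * s) y = 0 := by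
    change 𝒰.levPolyHom O hv φO n k c₀ (lv n) (max (lv n) 1) 1 (s * s) y = 0
    rw [← hx₀, ← 𝒰.resCohomology_symPolyHom_apply hv (engLatAction p O φO n k) h𝒰.out
      (𝒰.level_le_integralMonoid_of_forall_mem hv b₁ b₁) (𝒰.level_le_integralMonoid_of_forall_mem hv (lv n) (max (lv n) 1))
      (𝒰.level_antitone hlvn (hlvn.trans (le_max_left _ _))) hb₁1 (le_max_right _ _) c₀ (Ideal.Quotient.mk _) 1 (s * s) x₀]
    change (resCohomology (globalEmbedding 2 K) (integralMonoid K v) (engLatAction p O φO n k) _ 1).hom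
      (𝒰.levPolyHom O hv φO n k c₀ b₁ b₁ 1 (s * s) x₀) = 0
    rw [hsq, map_zero]
  refine EngMod.ext 𝒰 ?_
  change ((((s * s) • e).toEngMod : 𝒰.EngMod O lv n 1) : 𝒰.engCohomology O lv n 1) = ((0 : 𝒰.EngMod O lv n 1) : 𝒰.engCohomology O lv n 1)
  rw [𝒰.coe_twSmul_of_lift O lv hv φO n hred k c₀ hb₁1 hlvn hN 1 _ e hy hye, hy0, map_zero, EngMod.coe_zero]

include hN hpn τ₀ hfin hb₁1 hred in
/-- **`hs₁` in the form consumed by the levelwise engine**: `s² · E_n(1)^∨ ⊆ I_n · E_n(1)^∨`.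
[cite: Hida1994AIF, §3, proof of Thm 3.2] -/
theorem range_lsmul_characterModule_le_one (s : MvPolynomial (𝒰.Syms c₀) O)
    (hs1 : ∀ x : cohomology (globalEmbedding 2 K) (integralMonoid K v) (symLatticeAction O E K k v φO) (𝒰.level b₁ b₁) 1,
      𝒰.symPolyHom (symLatticeAction O E K k v φO) (𝒰.level_le_integralMonoid_of_forall_mem hv b₁ b₁) c₀
        (fun _ hg => 𝒰.goodElements_le_integralMonoid v hg) (fun u => diamondPi_mem_integralMonoid' v hv u)
        (RingHom.id O) h𝒰.out 1 s x = 0)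
    (hs2 : ∀ x : cohomology (globalEmbedding 2 K) (integralMonoid K v) (symLatticeAction O E K k v φO) (𝒰.level b₁ b₁) 2,
      𝒰.symPolyHom (symLatticeAction O E K k v φO) (𝒰.level_le_integralMonoid_of_forall_mem hv b₁ b₁) c₀
        (fun _ hg => 𝒰.goodElements_le_integralMonoid v hg) (fun u => diamondPi_mem_integralMonoid' v hv u)
        (RingHom.id O) h𝒰.out 2 s x = 0) :
    LinearMap.range (LinearMap.lsmul (MvPolynomial (𝒰.Syms c₀) O) (CharacterModule (𝒰.EngModTw O lv k c₀ n 1)) (s * s)) ≤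
      𝒰.diamIdeal O lv n c₀ hb₁ hlvn • (⊤ : Submodule (MvPolynomial (𝒰.Syms c₀) O) (CharacterModule (𝒰.EngModTw O lv k c₀ n 1))) :=
  smul_top_le_of_smul_torsionBySet_eq_zero _ (s * s) fun e he =>
    𝒰.mul_self_smul_eq_zero_of_mem_torsionBySet_one O lv hv φO n hred k c₀ hb₁ hb₁1 hlvn hN hpn τ₀ hfin s hs1 hs2 e he

end One

end TameLevel

end BigHeckeGLn

end Literature.NumberTheory.Automorphic
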